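import Summits.NavierStokesRegularity.NavierStokesRegularity.Theorems.SqueezeCycleExtremalBiaxialitySubcriticalOfLiouville
import Summits.NavierStokesRegularity.NavierStokesRegularity.Theorems.SqueezeCycleMustSqueezeSimDictionary
import Summits.NavierStokesRegularity.NavierStokesRegularity.Theorems.SqueezeCycleMustSqueezeEndgame
import Summits.NavierStokesRegularity.NavierStokesRegularity.Theorems.SqueezeCycleMustSqueezeGradEnergyBasic
import Summits.NavierStokesRegularity.NavierStokesRegularity.Theorems.SqueezeCycleMustSqueezeGradEnergyAverage
import Summits.NavierStokesRegularity.NavierStokesRegularity.Theorems.SqueezeCycleMustSqueezeDivCurlBalls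
import Summits.NavierStokesRegularity.NavierStokesRegularity.Theorems.SqueezeCycleMustSqueezeSignedBudget
import Summits.NavierStokesRegularity.NavierStokesRegularity.Theorems.SqueezeCycleMustSqueezeTwoPassGronwall
import Literature.Analysis.FluidPDE.LerayGaugeStrainSpectrum
import HarnessLib

/-!
# Route `SqueezeCycle`, crux `MustSqueeze` (stmt-NavierStokesRegularity-11610) — PROVED
  ("to blow up you must squeeze"; line outward-drift-signed-flux)

`squeezeCycle_mustSqueeze_proof : Summit.NavierStokesRegularity.NavierStokesRegularity.Theses.SqueezeCycle.MustSqueeze`: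
every element `u` of the Type-I model class `𝒦_C` (jointly smooth, divergence free, KNSS-mild in the
Oseen gauge, `‖u‖ ≤ C/√(−t)`, scaled local energies `A, E ≤ C`) whose Leray-gauge middle strain
eigenvalue satisfies `Λ_u ≤ 1/8` everywhere vanishes identically on `t < 0`.

Proof (signed-drift localisation of the similarity quarter-law; cards leaky-quarter-law /
outward-drift-signed-flux). Read `u` in backward similarity variables `U = lerayOrbit u`,
`Ω = lerayVorticity u = curl U`; localise the enstrophy with the radial, ray-monotone cutoff
`φ_R(y) = smoothTransition (2 − ‖y‖²/R²)`: `Z_R(s) = ∫ φ_R ‖Ω(s)‖²`, and let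
`E(ρ,s) = ∫_{B_ρ} ‖∇U(s)‖²_F`.
1. Dictionary (`stub_simDictionary`): `‖U‖ ≤ C`, `∫_{B_ρ(y₀)}‖U(s)‖² ≤ Cρ` (H4, H5a).
2. Gradient energies (`stub_gradEnergyBasic`, `stub_gradEnergyAverage`): `E ≥ 0`, continuous in `s`,
   monotone in `ρ`, `∫_s^{s+1} E(ρ) ≤ 6Cρ` for `ρ ≥ 1` (H5b).
3. Comparison (`stub_divCurlBalls`): `Z_R ≤ 6E(2R)`, `∫φ_R‖∇U‖²_F ≤ Z_R + κ'√(E(2R)/R)` (div–curl +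
   Morrey), `E(R) ≤ ∫φ_R‖∇U‖²_F`, `Z_R ↑` in `R`.
4. THE LEVER (`stub_signedBudget`): the similarity vorticity equation
   `∂ₛΩ + Ω + ½(y·∇)Ω + (U·∇)Ω = (Ω·∇)U + ΔΩ` (`IsTypeIAncientMild.lerayVorticity_eq`) tested with
   `Ω φ_R`, Betchov's sign law with Miller's middle-eigenvalue bound, the null-Lagrangian structure of
   `det ∇U`, and the SIGN of the Leray-drift flux (`y·∇φ_R ≤ 0`) give
   `Z_R' ≤ −2(¼ − ⅛) Z_R + K_R`, `0 ≤ K_R ≤ κ (E(2R)/R + √(E(2R)/R))`.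
5. Two backward-Grönwall passes (`stub_twoPassGronwall`; bounds uniform in `s` forbid backward
   exponentials): `Z` bounded, then `Z ≡ 0`, then `E ≡ 0`.
6. Endgame (`stub_endgame`): `∇U ≡ 0`, slices constant, Morrey kills the constant: `u ≡ 0`.
-/

noncomputable section

open MeasureTheory Set Filter Topology
open scoped RealInnerProductSpace

set_option linter.dupNamespace false

namespace Summit.NavierStokesRegularity.NavierStokesRegularity.Theorems

open Literature.Analysis.FluidPDE
open Summit.NavierStokesRegularity.NavierStokesRegularity.Theses.SqueezeCycle

/-- Physical / similarity space `ℝ³`. -/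
local notation "ℝ³" => EuclideanSpace ℝ (Fin 3)

/-- **`MustSqueeze` holds** ("to blow up you must squeeze"): an element of the Type-I KNSS-mild model
class `𝒦_C` whose Leray-gauge middle strain eigenvalue is `≤ 1/8` everywhere vanishes identically on
`t < 0`.  Composition of the seven stubs of line outward-drift-signed-flux: the inline class is the
tree's `IsTypeIAncientMild` (`isTypeIAncientMild_of_squeezeClass`), H6 is `Λ ≤ 1/8`
(`lerayMiddleStrain_le_iff`); dictionary, comparison and the signed enstrophy budget feed the abstract
two-pass backward Grönwall with `c = 2(¼ − ⅛) = ¼`, which kills every ball gradient energy of the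
similarity orbit, and the endgame returns `u ≡ 0`. [cite: Miller2019, Lemma 5.1; NeustupaPenel2001] -/
theorem squeezeCycle_mustSqueeze_proof :
    Summit.NavierStokesRegularity.NavierStokesRegularity.Theses.SqueezeCycle.MustSqueeze := by
  intro C u hu h6
  obtain ⟨h1, h2, h3, h4, h5⟩ := hu
  -- the inline class is the tree's Type-I KNSS-mild class
  have hK : IsTypeIAncientMild C u := isTypeIAncientMild_of_squeezeClass h1 h2 h3 h4
  -- H6 is `Λ ≤ 1/8` (Courant–Fischer)
  have hΛ : ∀ t < 0, ∀ x, lerayMiddleStrain u t x ≤ 1 / 8 := fun t ht x =>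
    (lerayMiddleStrain_le_iff ht (1 / 8)).2 (h6 t ht x)
  -- the stubs
  obtain ⟨hUle, hMorrey⟩ := stub_simDictionary C u hK h5
  obtain ⟨hE0, hEcont, hEmono⟩ := stub_gradEnergyBasic C u hK
  have hEavg := stub_gradEnergyAverage C u hK h5 hEcont
  obtain ⟨κ', hdc⟩ := stub_divCurlBalls C u hK hMorrey
  obtain ⟨κ, hbudget⟩ := stub_signedBudget C (1 / 8) κ' u hK hΛ (by norm_num) hUle hEcont
    (fun R s hR => (hdc R s hR).2.1)
  -- abstract two-pass Grönwall
  set Z : ℝ → ℝ → ℝ := fun R s =>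
    ∫ y, Real.smoothTransition (2 - ‖y‖ ^ 2 / R ^ 2) * ‖lerayVorticity u s y‖ ^ 2 with hZ
  set E : ℝ → ℝ → ℝ := fun ρ s =>
    ∫ y in Metric.ball (0 : ℝ³) ρ, frobeniusNormSq (fderiv ℝ (lerayOrbit u s) y) with hE
  have hc : (0 : ℝ) < 2 * (1 / 4 - 1 / 8) := by norm_num
  have hZ0 : ∀ R s : ℝ, 1 ≤ R → 0 ≤ Z R s := fun R s _ =>
    integral_nonneg fun y => mul_nonneg (Real.smoothTransition.nonneg _) (sq_nonneg _)
  have hbudget' : ∀ R : ℝ, 1 ≤ R → Differentiable ℝ (Z R) ∧ ∃ K : ℝ → ℝ, Continuous K ∧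
      (∀ s, 0 ≤ K s) ∧ (∀ s, K s ≤ κ * (E (2 * R) s / R + Real.sqrt (E (2 * R) s / R))) ∧
      ∀ s, deriv (Z R) s ≤ -(2 * (1 / 4 - 1 / 8)) * Z R s + K s := fun R hR => hbudget R hR
  have hvan : ∀ ρ s : ℝ, 0 < ρ → E ρ s = 0 :=
    stub_twoPassGronwall (2 * (1 / 4 - 1 / 8)) κ κ' (6 * C) Z E hc hE0 hEcont hEmono hEavg hbudget'
      hZ0 (fun R R' s hR hRR' => (hdc R s hR).2.2.2 R' hRR') (fun R s hR => (hdc R s hR).1)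
      (fun R s hR => ((hdc R s hR).2.2.1).trans ((hdc R s hR).2.1))
  exact stub_endgame C u hK hMorrey hvan

end Summit.NavierStokesRegularity.NavierStokesRegularity.Theorems

end
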